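import Mathlib
import Literature.Analysis.FluidPDE.Tao2016AveragedNS.WeightedLatticeFlows
import Literature.Analysis.ODE.LinearComparison
import HarnessLib

/-!
# Tao 2016, §4 / Barbato–Morandin–Romito 2011, §3.2: one stage of the dissipation bootstrap for the
# NS-scaled viscous cascade lattice

T. Tao, *Finite time blowup for an averaged three-dimensional Navier–Stokes equation*, J. Amer. Math.
Soc. **29** (2016), §4 (the viscous equation before Thm. 4.2, the main term (4.8)).
D. Barbato, F. Morandin, M. Romito, *Smooth solutions for the dyadic model*, Nonlinearity **24** (2011)
3083–3097, §3.1 Prop. 3.3 and §3.2 (the smoothing bootstrap: a geometric a priori decay with exponent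
above the critical one is improved step by step by the dissipation, `q ↦ 2q + 2 − β`).

Lemma layer (MODEL lattice ODEs only; nothing here concerns the Navier–Stokes equations):
* `abs_quadTerm_le_of_bounds` — pointwise bound on the cascade nonlinearity from bounds on the three
  shells it reads;
* `abs_le_of_dissipative_forcing` — the scalar Duhamel bound `|g| ≤ |g(0)| + sup|q|/κ` for
  `g' = q − κg`, `κ > 0` (the forcing is divided by the dissipation rate);
* `viscous_bootstrap_step` — one smoothing stage for a regular solution of the `ν`-viscous lattice:
  amplitudes `≤ D(1+ε₀)^{-γk}` (`k ≥ 0`) improve to `≤ D'(1+ε₀)^{-(2γ−1/2)k}` (BMR §3.2 transported to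
  base `1+ε₀` and a general table of structure constants).
-/

noncomputable section

open Set Metric Filter Topology BoundedContinuousFunction Finset

namespace Literature.Analysis.FluidPDE

namespace TaoCascade

variable {m : ℕ}

/-! ### Pointwise bound on the cascade nonlinearity from neighbouring shell bounds -/

/-- A bilinear block bound: `|Σ_{i₁,i₂} c (u i₁ · v i₂)| ≤ m² M_c B_u B_v`. [folklore] -/
private theorem abs_sum_sum_mul_le {c : Fin m → Fin m → ℝ} {u v : Fin m → ℝ} {Mc Bu Bv : ℝ}
    (hMc : 0 ≤ Mc) (hBu : 0 ≤ Bu) (hc : ∀ i j, |c i j| ≤ Mc) (hu : ∀ i, |u i| ≤ Bu)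
    (hv : ∀ j, |v j| ≤ Bv) :
    |∑ i, ∑ j, c i j * (u i * v j)| ≤ (m : ℝ) ^ 2 * Mc * (Bu * Bv) := by
  have hterm : ∀ i j, |c i j * (u i * v j)| ≤ Mc * (Bu * Bv) := fun i j => by
    rw [abs_mul, abs_mul]
    exact mul_le_mul (hc i j) (mul_le_mul (hu i) (hv j) (abs_nonneg _) hBu)
      (mul_nonneg (abs_nonneg _) (abs_nonneg _)) hMc
  calc |∑ i, ∑ j, c i j * (u i * v j)| ≤ ∑ i, |∑ j, c i j * (u i * v j)| := abs_sum_le_sum_abs _ _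
    _ ≤ ∑ i, ∑ j, |c i j * (u i * v j)| := sum_le_sum fun i _ => abs_sum_le_sum_abs _ _
    _ ≤ ∑ _i : Fin m, ∑ _j : Fin m, Mc * (Bu * Bv) :=
        sum_le_sum fun i _ => sum_le_sum fun j _ => hterm i j
    _ = (m : ℝ) ^ 2 * Mc * (Bu * Bv) := by
        rw [sum_const, sum_const, card_univ, Fintype.card_fin, nsmul_eq_mul, nsmul_eq_mul]; ring

/-- **Pointwise bound on the cascade nonlinearity (4.8) from bounds on the three shells it reads.**
If `|X_{j,n−1}| ≤ b₋`, `|X_{j,n}| ≤ b₀`, `|X_{j,n+1}| ≤ b₊` at time `t` (all `j`), then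
`|quadTerm_{i,n}(X)(t)| ≤ m² M_α ((1+ε₀)^{5n/2}(b₀² + 2 b₀ b₊) + (1+ε₀)^{5(n−1)/2} b₋²)`.
[cite: Tao2016AveragedNS, §4 (4.8) (the main term, shift set `S`)] -/
theorem abs_quadTerm_le_of_bounds {ε₀ Mα : ℝ} (hε : 0 ≤ 1 + ε₀) (hMα : 0 ≤ Mα)
    {α : Fin m → Fin m → Fin m → ℤ × ℤ × ℤ → ℝ} (hα : ∀ i₁ i₂ i₃ μ, |α i₁ i₂ i₃ μ| ≤ Mα)
    (X : Fin m → ℤ → ℝ → ℝ) (i : Fin m) (n : ℤ) (t : ℝ) {bm b0 bp : ℝ} (hb0 : 0 ≤ b0)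
    (hbm0 : 0 ≤ bm) (hm : ∀ j, |X j (n - 1) t| ≤ bm) (h0 : ∀ j, |X j n t| ≤ b0)
    (hp : ∀ j, |X j (n + 1) t| ≤ bp) :
    |quadTerm ε₀ α X i n t| ≤ (m : ℝ) ^ 2 * Mα *
      ((1 + ε₀) ^ ((5 : ℝ) * n / 2) * (b0 * b0 + 2 * (b0 * bp)) +
        (1 + ε₀) ^ ((5 : ℝ) * ((n : ℝ) - 1) / 2) * (bm * bm)) := by
  have hbp : 0 ≤ bp := (abs_nonneg _).trans (hp i)
  rw [quadTerm_four_shifts]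
  have h1 := abs_sum_sum_mul_le hMα hb0 (fun i₁ i₂ => hα i₁ i₂ i (0, 0, 0)) h0 h0
  have h2 := abs_sum_sum_mul_le hMα hbp (fun i₁ i₂ => hα i₁ i₂ i (1, 0, 0)) hp h0
  have h3 := abs_sum_sum_mul_le hMα hb0 (fun i₁ i₂ => hα i₁ i₂ i (0, 1, 0)) h0 hp
  have h4 := abs_sum_sum_mul_le hMα hbm0 (fun i₁ i₂ => hα i₁ i₂ i (0, 0, 1)) hm hm
  have hP : 0 ≤ (1 + ε₀) ^ ((5 : ℝ) * n / 2) := Real.rpow_nonneg hε _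
  have hQ : 0 ≤ (1 + ε₀) ^ ((5 : ℝ) * ((n : ℝ) - 1) / 2) := Real.rpow_nonneg hε _
  calc |(1 + ε₀) ^ ((5 : ℝ) * n / 2) *
          (∑ i₁, ∑ i₂, (α i₁ i₂ i (0, 0, 0) * (X i₁ n t * X i₂ n t) +
            α i₁ i₂ i (1, 0, 0) * (X i₁ (n + 1) t * X i₂ n t) +
            α i₁ i₂ i (0, 1, 0) * (X i₁ n t * X i₂ (n + 1) t))) +
        (1 + ε₀) ^ ((5 : ℝ) * ((n : ℝ) - 1) / 2) *
          ∑ i₁, ∑ i₂, α i₁ i₂ i (0, 0, 1) * (X i₁ (n - 1) t * X i₂ (n - 1) t)|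
      ≤ (1 + ε₀) ^ ((5 : ℝ) * n / 2) *
          |∑ i₁, ∑ i₂, (α i₁ i₂ i (0, 0, 0) * (X i₁ n t * X i₂ n t) +
            α i₁ i₂ i (1, 0, 0) * (X i₁ (n + 1) t * X i₂ n t) +
            α i₁ i₂ i (0, 1, 0) * (X i₁ n t * X i₂ (n + 1) t))| +
        (1 + ε₀) ^ ((5 : ℝ) * ((n : ℝ) - 1) / 2) *
          |∑ i₁, ∑ i₂, α i₁ i₂ i (0, 0, 1) * (X i₁ (n - 1) t * X i₂ (n - 1) t)| := by
        refine (abs_add_le _ _).trans ?_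
        rw [abs_mul, abs_mul, abs_of_nonneg hP, abs_of_nonneg hQ]
    _ ≤ (1 + ε₀) ^ ((5 : ℝ) * n / 2) * ((m : ℝ) ^ 2 * Mα * (b0 * b0) + (m : ℝ) ^ 2 * Mα * (bp * b0) +
          (m : ℝ) ^ 2 * Mα * (b0 * bp)) +
        (1 + ε₀) ^ ((5 : ℝ) * ((n : ℝ) - 1) / 2) * ((m : ℝ) ^ 2 * Mα * (bm * bm)) := by
        refine add_le_add (mul_le_mul_of_nonneg_left ?_ hP) (mul_le_mul_of_nonneg_left h4 hQ)
        simp only [sum_add_distrib]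
        exact ((abs_add_le _ _).trans (add_le_add (abs_add_le _ _) le_rfl)).trans
          (add_le_add (add_le_add h1 h2) h3)
    _ = _ := by ring

/-! ### The scalar dissipative Duhamel bound -/

/-- **Dissipative Duhamel bound.**  If `g' = q − κ g` on `[0,s]` (derivative within `[0,s]`),
`κ > 0` and `|q| ≤ Q` there, then `|g(t)| ≤ |g(0)| + Q/κ` on `[0,s]` — the forcing is divided by the
dissipation rate (variation of constants with `e^{−κ(t−r)} ≤ 1`, `∫₀ᵗ κ e^{−κ(t−r)} dr ≤ 1`).
[cite: BarbatoMorandinRomito2011, §3.1 Prop. 3.3 (proof: the dissipation gains the factor `λₙ²`); Teschl2012, §3.4 (3.97)] -/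
theorem abs_le_of_dissipative_forcing {g q : ℝ → ℝ} {s κ Q : ℝ} (hκ : 0 < κ)
    (hg : ∀ t ∈ Icc 0 s, HasDerivWithinAt g (q t - κ * g t) (Icc 0 s) t)
    (hq : ∀ t ∈ Icc 0 s, |q t| ≤ Q) : ∀ t ∈ Icc 0 s, |g t| ≤ |g 0| + Q / κ := by
  intro t ht
  have hs : 0 ≤ s := ht.1.trans ht.2
  have hQ0 : 0 ≤ Q := (abs_nonneg _).trans (hq 0 ⟨le_rfl, hs⟩)
  have hgc : ContinuousOn g (Icc 0 s) := fun u hu => (hg u hu).continuousWithinAt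
  have hg' : ∀ u ∈ Ico 0 s, HasDerivWithinAt g (q u - κ * g u) (Ici u) u := fun u hu =>
    (hg u (Ico_subset_Icc_self hu)).mono_of_mem_nhdsWithin
      (mem_of_superset (Icc_mem_nhdsGE hu.2) (Icc_subset_Icc hu.1 le_rfl))
  -- the explicit integrals
  have hI1 : ∀ u, ∫ r in (0 : ℝ)..u, (-κ : ℝ) = -κ * u := fun u => by simp; ring
  have hI2 : ∀ u, ∫ r in (0 : ℝ)..u, Q * Real.exp (-(∫ x in (0 : ℝ)..r, (-κ : ℝ))) =
      Q * ((Real.exp (κ * u) - 1) / κ) := by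
    intro u
    have h1 : ∀ r, Q * Real.exp (-(∫ x in (0 : ℝ)..r, (-κ : ℝ))) = Q * Real.exp (κ * r) := fun r => by
      rw [hI1]; ring_nf
    simp_rw [h1]
    rw [intervalIntegral.integral_const_mul]
    congr 1
    have hd : ∀ r ∈ uIcc (0 : ℝ) u, HasDerivAt (fun x => Real.exp (κ * x) / κ) (Real.exp (κ * r)) r := by
      intro r _
      have := ((hasDerivAt_id r).const_mul κ).exp.div_const κ
      simpa [mul_div_assoc, mul_comm, hκ.ne'] using this
    rw [intervalIntegral.integral_eq_sub_of_hasDerivAt hd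
      ((Real.continuous_exp.comp (continuous_const.mul continuous_id)).intervalIntegrable _ _)]
    simp; ring
  -- upper bound
  have hup := Literature.Analysis.ODE.le_linearComparison (A := fun _ => Q) (β := fun _ => -κ) hgc hg'
    continuousOn_const continuousOn_const (fun u hu => by
      have := (abs_le.1 (hq u (Ico_subset_Icc_self hu))).2; linarith) ht
  -- lower bound
  have hlo := Literature.Analysis.ODE.linearComparison_le (A := fun _ => -Q) (β := fun _ => -κ) hgc hg'
    continuousOn_const continuousOn_const (fun u hu => by
      have := (abs_le.1 (hq u (Ico_subset_Icc_self hu))).1; linarith) ht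
  have hI3 : ∫ r in (0 : ℝ)..t, -Q * Real.exp (-(∫ x in (0 : ℝ)..r, (-κ : ℝ))) =
      -(Q * ((Real.exp (κ * t) - 1) / κ)) := by
    rw [← hI2 t, ← intervalIntegral.integral_neg]
    congr 1; funext r; ring
  rw [hI1, hI2] at hup
  rw [hI1, hI3] at hlo
  have hE : Real.exp (-κ * t) * Real.exp (κ * t) = 1 := by rw [← Real.exp_add]; simp
  have hEpos : 0 < Real.exp (-κ * t) := Real.exp_pos _
  have hEle : Real.exp (-κ * t) ≤ 1 := Real.exp_le_one_iff.2 (by nlinarith [ht.1])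
  have hkey : Real.exp (-κ * t) * (Q * ((Real.exp (κ * t) - 1) / κ)) ≤ Q / κ := by
    rw [show Real.exp (-κ * t) * (Q * ((Real.exp (κ * t) - 1) / κ)) =
      (Q / κ) * (Real.exp (-κ * t) * Real.exp (κ * t) - Real.exp (-κ * t)) by ring, hE]
    have : 0 ≤ Q / κ := div_nonneg hQ0 hκ.le
    nlinarith
  have hg0 : Real.exp (-κ * t) * g 0 ≤ |g 0| ∧ -|g 0| ≤ Real.exp (-κ * t) * g 0 := by
    constructor
    · exact (le_abs_self _).trans (by rw [abs_mul, abs_of_pos hEpos]; exact mul_le_of_le_one_left (abs_nonneg _) hEle)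
    · have h := neg_abs_le (Real.exp (-κ * t) * g 0)
      rw [abs_mul, abs_of_pos hEpos] at h
      exact le_trans (neg_le_neg (mul_le_of_le_one_left (abs_nonneg _) hEle)) h
  rw [abs_le]
  constructor
  · have : Real.exp (-κ * t) * (g 0 + -(Q * ((Real.exp (κ * t) - 1) / κ))) ≤ g t := hlo
    nlinarith [hg0.2]
  · have : g t ≤ Real.exp (-κ * t) * (g 0 + Q * ((Real.exp (κ * t) - 1) / κ)) := hup
    nlinarith [hg0.1]

/-! ### One stage of the dissipation bootstrap -/

/-- **One smoothing stage (BMR §3.2 transported).**  Let `X` solve the `ν`-viscous lattice on `[0,s]`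
(`ν > 0`), vanish below shell `0`, have datum bounded by `B₀` at shell `0` and vanishing elsewhere,
and obey `|X_{i,k}(t)| ≤ D(1+ε₀)^{-γk}` for all shells `k ≥ 0` (`γ ≥ 0`).  Then
`|X_{i,k}(t)| ≤ (B₀ + 4 m² M_α (1+ε₀)^{2γ} D²/ν) (1+ε₀)^{-(2γ − 1/2)k}` for `k ≥ 0`: the nonlinearity
is `≤ 4 m² M_α (1+ε₀)^{5k/2} b²` with `b = D(1+ε₀)^{γ−γk}` and the dissipation divides it by
`ν(1+ε₀)^{2k}` (`abs_le_of_dissipative_forcing`).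
[cite: BarbatoMorandinRomito2011, §3.2 (proof of Thm. 1: the exponent improves `q ↦ 2q + 2 − β`) and §3.1 Prop. 3.3; Tao2016AveragedNS, §4 (viscous equation before Thm. 4.2)] -/
theorem viscous_bootstrap_step {ε₀ ν Mα D γ B₀ s : ℝ} (hε₀ : 0 ≤ ε₀) (hν : 0 < ν) (hMα : 0 ≤ Mα)
    (hD : 0 ≤ D) (hγ : 0 ≤ γ) (hB₀ : 0 ≤ B₀)
    {α : Fin m → Fin m → Fin m → ℤ × ℤ × ℤ → ℝ} (hα : ∀ i₁ i₂ i₃ μ, |α i₁ i₂ i₃ μ| ≤ Mα)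
    {X : Fin m → ℤ → ℝ → ℝ} (h00 : ∀ i, |X i 0 0| ≤ B₀) (h0 : ∀ i k, k ≠ 0 → X i k 0 = 0)
    (hlow : ∀ i k, k < 0 → ∀ t ∈ Icc 0 s, X i k t = 0)
    (hder : ∀ i k, ∀ t ∈ Icc 0 s, HasDerivWithinAt (X i k)
      (quadTerm ε₀ α X i k t - ν * (1 + ε₀) ^ ((2 : ℝ) * k) * X i k t) (Icc 0 s) t)
    (hb : ∀ i (k : ℤ), 0 ≤ k → ∀ t ∈ Icc 0 s, |X i k t| ≤ D * (1 + ε₀) ^ (-(γ * k))) :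
    ∀ i (k : ℤ), 0 ≤ k → ∀ t ∈ Icc 0 s, |X i k t| ≤
      (B₀ + 4 * (m : ℝ) ^ 2 * Mα * (1 + ε₀) ^ (2 * γ) * D ^ 2 / ν) *
        (1 + ε₀) ^ (-((2 * γ - 1 / 2) * k)) := by
  intro i k hk t ht
  have hl1 : (1 : ℝ) ≤ 1 + ε₀ := by linarith
  have hl0 : (0 : ℝ) < 1 + ε₀ := by linarith
  have hkr : (0 : ℝ) ≤ k := by exact_mod_cast hk
  -- the common bound on the three shells read by `quadTerm_{i,k}`
  set b : ℝ := D * (1 + ε₀) ^ γ * (1 + ε₀) ^ (-(γ * k)) with hbdef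
  have hb0' : 0 ≤ b := by positivity
  have hpk : 0 ≤ (1 + ε₀) ^ (-(γ * k)) := Real.rpow_nonneg hl0.le _
  have hDb : D * (1 + ε₀) ^ (-(γ * k)) ≤ b := by
    rw [hbdef]
    have : D * (1 + ε₀) ^ (-(γ * k)) * 1 ≤ D * (1 + ε₀) ^ (-(γ * k)) * (1 + ε₀) ^ γ :=
      mul_le_mul_of_nonneg_left (Real.one_le_rpow hl1 hγ) (mul_nonneg hD hpk)
    linarith
  have hbk : ∀ τ ∈ Icc 0 s, ∀ j, |X j k τ| ≤ b := fun τ hτ j => (hb j k hk τ hτ).trans hDb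
  have hbk1 : ∀ τ ∈ Icc 0 s, ∀ j, |X j (k + 1) τ| ≤ b := fun τ hτ j => by
    refine (hb j (k + 1) (by omega) τ hτ).trans (le_trans ?_ hDb)
    refine mul_le_mul_of_nonneg_left (Real.rpow_le_rpow_of_exponent_le hl1 ?_) hD
    push_cast; nlinarith
  have hbkm : ∀ τ ∈ Icc 0 s, ∀ j, |X j (k - 1) τ| ≤ b := fun τ hτ j => by
    rcases eq_or_lt_of_le hk with h | h
    · rw [hlow j (k - 1) (by omega) τ hτ, abs_zero]; exact hb0'
    · refine (hb j (k - 1) (by omega) τ hτ).trans (le_of_eq ?_)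
      rw [hbdef, mul_assoc, ← Real.rpow_add hl0]
      congr 1; push_cast; ring_nf
  -- the nonlinearity
  have hQ : ∀ τ ∈ Icc 0 s, |quadTerm ε₀ α X i k τ| ≤
      4 * (m : ℝ) ^ 2 * Mα * (1 + ε₀) ^ ((5 : ℝ) * k / 2) * b ^ 2 := by
    intro τ hτ
    refine (abs_quadTerm_le_of_bounds hl0.le hMα hα X i k τ hb0' hb0' (hbkm τ hτ) (hbk τ hτ)
      (hbk1 τ hτ)).trans ?_
    have hP : (1 + ε₀) ^ ((5 : ℝ) * ((k : ℝ) - 1) / 2) ≤ (1 + ε₀) ^ ((5 : ℝ) * k / 2) :=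
      Real.rpow_le_rpow_of_exponent_le hl1 (by linarith)
    have hP0 : 0 ≤ (1 + ε₀) ^ ((5 : ℝ) * k / 2) := Real.rpow_nonneg hl0.le _
    have h1 : (1 + ε₀) ^ ((5 : ℝ) * ((k : ℝ) - 1) / 2) * (b * b) ≤ (1 + ε₀) ^ ((5 : ℝ) * k / 2) * (b * b) :=
      mul_le_mul_of_nonneg_right hP (mul_nonneg hb0' hb0')
    have hm2 : 0 ≤ (m : ℝ) ^ 2 * Mα := by positivity
    nlinarith [mul_le_mul_of_nonneg_left h1 hm2]
  -- the dissipative bound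
  have hκ : 0 < ν * (1 + ε₀) ^ ((2 : ℝ) * k) := mul_pos hν (Real.rpow_pos_of_pos hl0 _)
  have hdiss := abs_le_of_dissipative_forcing hκ (hder i k) hQ t ht
  -- bookkeeping of the exponents
  have hE : 4 * (m : ℝ) ^ 2 * Mα * (1 + ε₀) ^ ((5 : ℝ) * k / 2) * b ^ 2 / (ν * (1 + ε₀) ^ ((2 : ℝ) * k)) =
      4 * (m : ℝ) ^ 2 * Mα * (1 + ε₀) ^ (2 * γ) * D ^ 2 / ν * (1 + ε₀) ^ (-((2 * γ - 1 / 2) * k)) := by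
    have e2 : ((1 + ε₀) ^ γ) ^ 2 = (1 + ε₀) ^ (2 * γ) := by
      rw [sq, ← Real.rpow_add hl0]; ring_nf
    have e3 : (1 + ε₀) ^ ((5 : ℝ) * k / 2) * ((1 + ε₀) ^ (-(γ * k))) ^ 2 =
        (1 + ε₀) ^ (-((2 * γ - 1 / 2) * k)) * (1 + ε₀) ^ ((2 : ℝ) * k) := by
      rw [sq, ← Real.rpow_add hl0, ← Real.rpow_add hl0, ← Real.rpow_add hl0]
      congr 1; ring
    have hH : (1 + ε₀) ^ ((2 : ℝ) * k) ≠ 0 := (Real.rpow_pos_of_pos hl0 _).ne'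
    rw [hbdef, ← e2, mul_pow, mul_pow, div_eq_iff (mul_ne_zero hν.ne' hH)]
    calc 4 * (m : ℝ) ^ 2 * Mα * (1 + ε₀) ^ ((5 : ℝ) * k / 2) *
          (D ^ 2 * ((1 + ε₀) ^ γ) ^ 2 * ((1 + ε₀) ^ (-(γ * k))) ^ 2)
        = 4 * (m : ℝ) ^ 2 * Mα * D ^ 2 * ((1 + ε₀) ^ γ) ^ 2 *
            ((1 + ε₀) ^ ((5 : ℝ) * k / 2) * ((1 + ε₀) ^ (-(γ * k))) ^ 2) := by ring
      _ = 4 * (m : ℝ) ^ 2 * Mα * D ^ 2 * ((1 + ε₀) ^ γ) ^ 2 *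
            ((1 + ε₀) ^ (-((2 * γ - 1 / 2) * k)) * (1 + ε₀) ^ ((2 : ℝ) * k)) := by rw [e3]
      _ = 4 * (m : ℝ) ^ 2 * Mα * ((1 + ε₀) ^ γ) ^ 2 * D ^ 2 / ν *
            (1 + ε₀) ^ (-((2 * γ - 1 / 2) * k)) * (ν * (1 + ε₀) ^ ((2 : ℝ) * k)) := by
          field_simp
  rcases eq_or_lt_of_le hk with h | h
  · -- shell `0`
    subst h
    have h1 : |X i 0 0| ≤ B₀ := h00 i
    simp only [Int.cast_zero, mul_zero, neg_zero, Real.rpow_zero, mul_one] at hdiss hE ⊢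
    calc |X i 0 t| ≤ |X i 0 0| + 4 * (m : ℝ) ^ 2 * Mα * (1 + ε₀) ^ ((5 : ℝ) * (0 : ℝ) / 2) * b ^ 2 /
          (ν * (1 + ε₀) ^ ((2 : ℝ) * (0 : ℝ))) := by simpa using hdiss
      _ ≤ B₀ + 4 * (m : ℝ) ^ 2 * Mα * (1 + ε₀) ^ (2 * γ) * D ^ 2 / ν := by
          have : 4 * (m : ℝ) ^ 2 * Mα * (1 + ε₀) ^ ((5 : ℝ) * (0 : ℝ) / 2) * b ^ 2 /
              (ν * (1 + ε₀) ^ ((2 : ℝ) * (0 : ℝ))) =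
              4 * (m : ℝ) ^ 2 * Mα * (1 + ε₀) ^ (2 * γ) * D ^ 2 / ν := by simpa using hE
          linarith
  · -- shells `k ≥ 1`
    have hk0 : k ≠ 0 := by omega
    rw [h0 i k hk0, abs_zero, zero_add, hE] at hdiss
    refine hdiss.trans ?_
    have hp : 0 ≤ (1 + ε₀) ^ (-((2 * γ - 1 / 2) * k)) := Real.rpow_nonneg hl0.le _
    nlinarith [mul_nonneg hB₀ hp]

end TaoCascade

end Literature.Analysis.FluidPDE

end
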